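import Summits.QuantumFields.QCD.Theorems.SpectralDefectExtinctionTipNoBindingFreeSymbol
import Literature.MathematicalPhysics.QuantumFieldTheory.SpectralDefectDensity

/-!
# A gauge field whose Wilson–Dirac operator has no real eigenvalue: the constant diagonal twist
(helper for the support item `PositivityDeficitLeDefects`, stmt-QuantumFields-8970, route
`SpectralDefectExtinction` of `Summit.QuantumFields.QCD`)

The item divides by the phase-quenched normalisation `∫ ∏_f |det D_W(U, m_f, 1)| dμ_W`, so its truth needs
this integral to be POSITIVE for every torus side `L ≥ 1`, every coupling and every tuple of bare masses;
since the Wilson measure charges open sets (tree `integral_norm_det_diracMatrix_pos_of_exists`) it suffices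
to exhibit ONE gauge field `U₀` with `det D_W(U₀, m, 1) ≠ 0` for ALL real `m`, i.e. whose massless `r = 1`
Wilson–Dirac operator has no real eigenvalue at all.  The free field does not qualify (doubler modes at
`m ∈ {0, −2, −4, −6, −8}`), nor does a `ℤ₃` centre twist when `3 ∣ L`.  We use the constant diagonal field
`U₀ ≡ V = diag(e^{iθ₁}, e^{iθ₂}, e^{iθ₃}) ∈ SU(3)` on every link, with `θ = (π/4L, π/4L, −π/2L)`:

* `wilsonDirac_const_diag_mulVec_apply` — entrywise action: colour `a` sees the free operator with the
  forward hops multiplied by `e^{iθ_a}` and the backward hops by `e^{−iθ_a}`;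
* `torusFourier_const_diag_sub_apply`, `sum_norm_sq_torusFourier_const_diag_sub` — in torus Fourier
  variables (toolkit of the `TipNoBinding` line: shift multipliers, the Clifford identity
  `‖((W−t) + iγ·s)v‖² = ((W−t)² + |s|²)‖v‖²`, Plancherel) the operator minus a real `t` acts at momentum `k`
  on colour `a` by the normal symbol with the SHIFTED angles `φ_μ = 2π k_μ/L + θ_a`;
* `wilsonDirac_const_diag_sub_injective` — if no shifted angle has `sin φ_μ = 0`, the symbol is invertible
  at every momentum, so `D_W(U₀,0,1) − t` is injective for every real `t`;
* `exists_gaugeConfig_forall_fermionDet_ne_zero` — with the angles above `sin φ ≠ 0` always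
  (`8k+1` and `4k−1` are odd), whence a configuration with `det D_W(U₀, m, 1) ≠ 0` for all real `m`.
-/

namespace Summit.QuantumFields.QCD.Theorems.PositivityDeficitLeDefects

open Literature.MathematicalPhysics Literature.MathematicalPhysics.QuantumLattice
  Literature.MathematicalPhysics.QuantumFieldTheory Literature.Probability.LatticeModels
open Summit.QuantumFields.QCD.Cruxes.TipNoBinding.PositivityNoLeakSpread
open Matrix Complex Finset
open scoped ComplexConjugate Real

section ConstDiag

variable {L : ℕ} [NeZero L] (θ : Fin 3 → ℝ) (V : SU3)
  (hV : (V : Matrix (Fin 3) (Fin 3) ℂ) = diagonal fun a => cexp (θ a * I))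

include hV

/-- The inverse link carries the conjugate phases: `V⁻¹ = diag(e^{−iθ_a})`. -/
theorem const_diag_coe_inv :
    ((V⁻¹ : SU3) : Matrix (Fin 3) (Fin 3) ℂ) = diagonal fun a => cexp (-(θ a * I)) := by
  rw [← Matrix.star_eq_inv, Matrix.specialUnitaryGroup.coe_star, hV, Matrix.star_eq_conjTranspose,
    diagonal_conjTranspose]
  congr 1
  funext a
  rw [Pi.star_apply, Complex.star_def, ← Complex.exp_conj, map_mul, Complex.conj_ofReal, Complex.conj_I,
    mul_neg]

/-- **Entrywise action of the Wilson–Dirac operator in the constant diagonal field `U ≡ V`**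
(`r = 1`, massless): colour `a` sees the free operator with forward hops dressed by `e^{iθ_a}` and
backward hops by `e^{−iθ_a}`,
`(Dψ)(x,a,α) = 4ψ(x,a,α) − ½ Σ_μ Σ_β [(1 − γ_μ)_{αβ} e^{iθ_a} ψ(x+μ̂,a,β) + (1 + γ_μ)_{αβ} e^{−iθ_a} ψ(x−μ̂,a,β)]`. -/
theorem wilsonDirac_const_diag_mulVec_apply (ψ : TorusSite 4 L × Fin 3 × Fin 4 → ℂ)
    (x : TorusSite 4 L) (a : Fin 3) (α : Fin 4) :
    (wilsonDirac (fundamentalRep (Fin 3)) (fun _ : Edge 4 L => V) 0 1 *ᵥ ψ) (x, a, α) =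
      4 * ψ (x, a, α) - (1 / 2) * ∑ μ, ∑ β,
        ((1 - euclideanGamma μ) α β * (cexp (θ a * I) * ψ (x + Pi.single μ 1, a, β)) +
          (1 + euclideanGamma μ) α β * (cexp (-(θ a * I)) * ψ (x - Pi.single μ 1, a, β))) := by
  have hf : ∀ μ : Fin 4, ∑ q : TorusSite 4 L × Fin 3 × Fin 4,
      (if q.1 = QuantumFieldTheory.Site.shift x μ then
          (1 - euclideanGamma μ) α q.2.2 * (diagonal fun a => cexp (θ a * I)) a q.2.1 else 0) * ψ q =
        ∑ β, (1 - euclideanGamma μ) α β * (cexp (θ a * I) * ψ (x + Pi.single μ 1, a, β)) := by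
    intro μ
    rw [Fintype.sum_prod_type, Finset.sum_eq_single (QuantumFieldTheory.Site.shift x μ)]
    · rw [Fintype.sum_prod_type, Finset.sum_eq_single a]
      · simp [QuantumFieldTheory.Site.shift, mul_assoc]
      · intro b _ hb
        simp [diagonal_apply_ne _ (Ne.symm hb)]
      · simp
    · intro y _ hy
      simp [if_neg hy]
    · simp
  have hb : ∀ μ : Fin 4, ∑ q : TorusSite 4 L × Fin 3 × Fin 4,
      (if x = QuantumFieldTheory.Site.shift q.1 μ then
          (1 + euclideanGamma μ) α q.2.2 * (diagonal fun a => cexp (-(θ a * I))) a q.2.1 else 0) * ψ q =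
        ∑ β, (1 + euclideanGamma μ) α β * (cexp (-(θ a * I)) * ψ (x - Pi.single μ 1, a, β)) := by
    intro μ
    simp_rw [eq_shift_iff]
    rw [Fintype.sum_prod_type, Finset.sum_eq_single (x - Pi.single μ 1)]
    · rw [Fintype.sum_prod_type, Finset.sum_eq_single a]
      · simp [mul_assoc]
      · intro b _ hb
        simp [diagonal_apply_ne _ (Ne.symm hb)]
      · simp
    · intro y _ hy
      simp [if_neg hy]
    · simp
  simp only [mulVec, dotProduct, wilsonDirac, of_apply, fundamentalRep_apply, hV, const_diag_coe_inv θ V hV,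
    Complex.ofReal_one, one_smul, sub_mul, Finset.sum_sub_distrib]
  congr 1
  · rw [Finset.sum_eq_single (x, a, α)]
    · simp
    · intro q _ hq
      rw [if_neg (Ne.symm hq), zero_mul]
    · intro h; exact absurd (Finset.mem_univ _) h
  · simp_rw [Finset.mul_sum, Finset.sum_mul]
    rw [Finset.sum_comm]
    refine Finset.sum_congr rfl fun μ _ => ?_
    simp_rw [mul_assoc, ← Finset.mul_sum]
    congr 1
    simp_rw [add_mul, Finset.sum_add_distrib, hf, hb]

/-- **The twisted operator in Fourier variables** (per colour `a`, at momentum `k`): with the SHIFTED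
angles `φ_μ = 2π k_μ.val/L + θ_a`, `W = Σ_μ (1 − cos φ_μ)`, `s_μ = sin φ_μ` and `Ψ_β = 𝓕(ψ(·,a,β))(k)`,
`𝓕((D − t)ψ(·,a,α))(k) = (W − t) Ψ_α + i Σ_β (Σ_μ s_μ γ_μ)_{αβ} Ψ_β` — the phases `e^{±iθ_a}` combine with
the shift multipliers `χ_k(±e_μ) = e^{±2πi k_μ/L}`. -/
theorem torusFourier_const_diag_sub_apply (ψ : TorusSite 4 L × Fin 3 × Fin 4 → ℂ) (t : ℝ)
    (k : TorusSite 4 L) (a : Fin 3) (α : Fin 4) :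
    torusFourier (fun x => (wilsonDirac (fundamentalRep (Fin 3)) (fun _ : Edge 4 L => V) 0 1 *ᵥ ψ -
        (t : ℂ) • ψ) (x, a, α)) k =
      (((∑ μ, (1 - Real.cos (2 * π * ((k μ).val : ℝ) / L + θ a))) - t : ℝ) : ℂ) *
          torusFourier (fun x => ψ (x, a, α)) k +
        I * ∑ β, (∑ μ, ((Real.sin (2 * π * ((k μ).val : ℝ) / L + θ a) : ℝ) : ℂ) • euclideanGamma μ) α β *
          torusFourier (fun x => ψ (x, a, β)) k := by
  -- the dressed character at a unit vector and its conjugate, in terms of `cos φ_μ`, `sin φ_μ`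
  have hχ : ∀ μ : Fin 4, cexp (θ a * I) * torusChar k (Pi.single μ 1) =
      ((Real.cos (2 * π * ((k μ).val : ℝ) / L + θ a) : ℝ) : ℂ) +
        ((Real.sin (2 * π * ((k μ).val : ℝ) / L + θ a) : ℝ) : ℂ) * I := by
    intro μ
    rw [torusChar_single_eq_exp, ← Complex.exp_add, Complex.ofReal_cos, Complex.ofReal_sin,
      ← Complex.exp_mul_I]
    congr 1
    push_cast
    ring
  have hχc : ∀ μ : Fin 4, cexp (-(θ a * I)) * conj (torusChar k (Pi.single μ 1)) =
      ((Real.cos (2 * π * ((k μ).val : ℝ) / L + θ a) : ℝ) : ℂ) -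
        ((Real.sin (2 * π * ((k μ).val : ℝ) / L + θ a) : ℝ) : ℂ) * I := by
    intro μ
    have h1 : cexp (-(θ a * I)) * conj (torusChar k (Pi.single μ 1)) =
        conj (cexp (θ a * I) * torusChar k (Pi.single μ 1)) := by
      rw [map_mul, ← Complex.exp_conj, map_mul, Complex.conj_ofReal, Complex.conj_I, mul_neg]
    rw [h1, hχ, map_add, map_mul, Complex.conj_ofReal, Complex.conj_ofReal, Complex.conj_I]
    ring
  -- one hopping term (direction `μ`, spin component `β`) in Fourier variables
  have h1 : ∀ μ β : Fin 4, torusFourier (fun x =>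
      (1 - euclideanGamma μ) α β * (cexp (θ a * I) * ψ (x + Pi.single μ 1, a, β)) +
        (1 + euclideanGamma μ) α β * (cexp (-(θ a * I)) * ψ (x - Pi.single μ 1, a, β))) k =
      (if α = β then 2 * ((Real.cos (2 * π * ((k μ).val : ℝ) / L + θ a) : ℝ) : ℂ) *
          torusFourier (fun x => ψ (x, a, β)) k else 0) -
        2 * (((Real.sin (2 * π * ((k μ).val : ℝ) / L + θ a) : ℝ) : ℂ) * I) *
          (euclideanGamma μ α β * torusFourier (fun x => ψ (x, a, β)) k) := by
    intro μ β
    rw [torusFourier_add', torusFourier_const_mul, torusFourier_const_mul, torusFourier_const_mul,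
      torusFourier_const_mul, torusFourier_comp_add (fun x => ψ (x, a, β)),
      torusFourier_comp_sub (fun x => ψ (x, a, β)), ← mul_assoc (cexp (θ a * I)),
      ← mul_assoc (cexp (-(θ a * I))), hχc, hχ, Matrix.sub_apply, Matrix.add_apply, Matrix.one_apply]
    split_ifs <;> ring
  -- the whole hopping part in Fourier variables
  have hhop : torusFourier (fun x => ∑ μ, ∑ β,
      ((1 - euclideanGamma μ) α β * (cexp (θ a * I) * ψ (x + Pi.single μ 1, a, β)) +
        (1 + euclideanGamma μ) α β * (cexp (-(θ a * I)) * ψ (x - Pi.single μ 1, a, β)))) k =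
      2 * (∑ μ, ((Real.cos (2 * π * ((k μ).val : ℝ) / L + θ a) : ℝ) : ℂ)) *
          torusFourier (fun x => ψ (x, a, α)) k -
        2 * (I * ∑ β, (∑ μ, ((Real.sin (2 * π * ((k μ).val : ℝ) / L + θ a) : ℝ) : ℂ) •
          euclideanGamma μ) α β * torusFourier (fun x => ψ (x, a, β)) k) := by
    have h2 : ∀ μ : Fin 4, torusFourier (fun x => ∑ β,
        ((1 - euclideanGamma μ) α β * (cexp (θ a * I) * ψ (x + Pi.single μ 1, a, β)) +
          (1 + euclideanGamma μ) α β * (cexp (-(θ a * I)) * ψ (x - Pi.single μ 1, a, β)))) k =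
        2 * ((Real.cos (2 * π * ((k μ).val : ℝ) / L + θ a) : ℝ) : ℂ) *
            torusFourier (fun x => ψ (x, a, α)) k -
          2 * (((Real.sin (2 * π * ((k μ).val : ℝ) / L + θ a) : ℝ) : ℂ) * I) *
            ∑ β, euclideanGamma μ α β * torusFourier (fun x => ψ (x, a, β)) k := by
      intro μ
      rw [torusFourier_finset_sum, Finset.sum_congr rfl fun β _ => h1 μ β, Finset.sum_sub_distrib,
        Finset.sum_ite_eq, if_pos (Finset.mem_univ _), ← Finset.mul_sum]
    rw [torusFourier_finset_sum, Finset.sum_congr rfl fun μ _ => h2 μ, Finset.sum_sub_distrib,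
      ← Finset.sum_mul, ← Finset.mul_sum]
    congr 1
    simp only [Matrix.sum_apply, Matrix.smul_apply, smul_eq_mul, Finset.mul_sum, Finset.sum_mul]
    conv_lhs => rw [Finset.sum_comm]
    refine Finset.sum_congr rfl fun β _ => Finset.sum_congr rfl fun μ _ => ?_
    ring
  -- assemble
  simp only [Pi.sub_apply, Pi.smul_apply, smul_eq_mul, wilsonDirac_const_diag_mulVec_apply θ V hV]
  rw [torusFourier_sub', torusFourier_sub', torusFourier_const_mul, torusFourier_const_mul,
    torusFourier_const_mul, hhop]
  push_cast
  rw [Finset.sum_sub_distrib]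
  simp only [Finset.sum_const, Finset.card_univ, Fintype.card_fin]
  ring

/-- **`|symbol|²` per colour and momentum** for the twisted operator:
`Σ_α |𝓕((D − t)ψ(·,a,α))(k)|² = ((W − t)² + Σ_μ sin² φ_μ) · Σ_α |𝓕(ψ(·,a,α))(k)|²` with the shifted angles
`φ_μ = 2π k_μ.val/L + θ_a` (Clifford: the symbol `(W − t) + iγ·s` is normal). -/
theorem sum_norm_sq_torusFourier_const_diag_sub (ψ : TorusSite 4 L × Fin 3 × Fin 4 → ℂ) (t : ℝ)
    (k : TorusSite 4 L) (a : Fin 3) :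
    ∑ α, ‖torusFourier (fun x => (wilsonDirac (fundamentalRep (Fin 3)) (fun _ : Edge 4 L => V) 0 1 *ᵥ ψ -
        (t : ℂ) • ψ) (x, a, α)) k‖ ^ 2 =
      (((∑ μ, (1 - Real.cos (2 * π * ((k μ).val : ℝ) / L + θ a))) - t) ^ 2 +
          ∑ μ, Real.sin (2 * π * ((k μ).val : ℝ) / L + θ a) ^ 2) *
        ∑ α, ‖torusFourier (fun x => ψ (x, a, α)) k‖ ^ 2 := by
  set w : ℝ := (∑ μ, (1 - Real.cos (2 * π * ((k μ).val : ℝ) / L + θ a))) - t with hw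
  set s : Fin 4 → ℝ := fun μ => Real.sin (2 * π * ((k μ).val : ℝ) / L + θ a) with hs
  set v : Fin 4 → ℂ := fun β => torusFourier (fun x => ψ (x, a, β)) k with hv
  set M : Matrix (Fin 4) (Fin 4) ℂ :=
    (w : ℂ) • (1 : Matrix (Fin 4) (Fin 4) ℂ) + I • ∑ μ, ((s μ : ℝ) : ℂ) • euclideanGamma μ with hM
  have hMv : ∀ α, torusFourier (fun x => (wilsonDirac (fundamentalRep (Fin 3))
      (fun _ : Edge 4 L => V) 0 1 *ᵥ ψ - (t : ℂ) • ψ) (x, a, α)) k = (M *ᵥ v) α := by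
    intro α
    rw [torusFourier_const_diag_sub_apply θ V hV, hM, add_mulVec, smul_mulVec, smul_mulVec, one_mulVec,
      Pi.add_apply, Pi.smul_apply, Pi.smul_apply, smul_eq_mul, smul_eq_mul, mulVec, dotProduct]
  calc ∑ α, ‖torusFourier (fun x => (wilsonDirac (fundamentalRep (Fin 3))
        (fun _ : Edge 4 L => V) 0 1 *ᵥ ψ - (t : ℂ) • ψ) (x, a, α)) k‖ ^ 2
      = ∑ α, ‖(M *ᵥ v) α‖ ^ 2 := Finset.sum_congr rfl fun α _ => by rw [hMv]
    _ = (w ^ 2 + ∑ μ, s μ ^ 2) * ∑ α, ‖v α‖ ^ 2 :=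
        sum_norm_sq_mulVec_of_conjTranspose_mul_self M _ (clifford_conjTranspose_mul_self w s) v

/-- **No real eigenvalue for a non-resonant twist.**  If no shifted angle is a multiple of `π`
(`sin (2π k/L + θ_a) ≠ 0` for all colours `a` and all `k : ZMod L`), then for every real `t` the operator
`D_W(U₀, 0, 1) − t` of the constant diagonal field `U₀ ≡ V` is injective: the symbol is invertible at every
momentum and colour, so the Fourier transform of a solution vanishes identically (Plancherel). -/
theorem wilsonDirac_const_diag_sub_injective
    (hθ : ∀ (a : Fin 3) (j : ZMod L), Real.sin (2 * π * ((j.val : ℕ) : ℝ) / L + θ a) ≠ 0)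
    (t : ℝ) (ψ : TorusSite 4 L × Fin 3 × Fin 4 → ℂ)
    (hψ : wilsonDirac (fundamentalRep (Fin 3)) (fun _ : Edge 4 L => V) 0 1 *ᵥ ψ - (t : ℂ) • ψ = 0) :
    ψ = 0 := by
  -- the Fourier transform of `ψ` vanishes, colour by colour and momentum by momentum
  have hF : ∀ (k : TorusSite 4 L) (a : Fin 3) (α : Fin 4), torusFourier (fun x => ψ (x, a, α)) k = 0 := by
    intro k a
    have hq : 0 < ((∑ μ, (1 - Real.cos (2 * π * ((k μ).val : ℝ) / L + θ a))) - t) ^ 2 +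
        ∑ μ, Real.sin (2 * π * ((k μ).val : ℝ) / L + θ a) ^ 2 := by
      have h1 : Real.sin (2 * π * (((k 0).val : ℕ) : ℝ) / L + θ a) ^ 2 ≤
          ∑ μ, Real.sin (2 * π * ((k μ).val : ℝ) / L + θ a) ^ 2 :=
        Finset.single_le_sum (f := fun μ => Real.sin (2 * π * ((k μ).val : ℝ) / L + θ a) ^ 2)
          (fun μ _ => sq_nonneg _) (Finset.mem_univ 0)
      have h2 : 0 < Real.sin (2 * π * (((k 0).val : ℕ) : ℝ) / L + θ a) ^ 2 :=
        lt_of_le_of_ne (sq_nonneg _) (Ne.symm (pow_ne_zero 2 (hθ a (k 0))))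
      nlinarith [sq_nonneg ((∑ μ, (1 - Real.cos (2 * π * ((k μ).val : ℝ) / L + θ a))) - t)]
    have hsum := sum_norm_sq_torusFourier_const_diag_sub θ V hV ψ t k a
    simp only [hψ, Pi.zero_apply] at hsum
    have hz : torusFourier (fun _ : TorusSite 4 L => (0 : ℂ)) k = 0 := by simp [torusFourier]
    rw [hz, norm_zero] at hsum
    simp only [ne_eq, OfNat.ofNat_ne_zero, not_false_eq_true, zero_pow, Finset.sum_const_zero] at hsum
    have hS : ∑ α, ‖torusFourier (fun x => ψ (x, a, α)) k‖ ^ 2 = 0 := by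
      rcases mul_eq_zero.1 hsum.symm with h | h
      · exact absurd h hq.ne'
      · exact h
    intro α
    have := (Finset.sum_eq_zero_iff_of_nonneg fun β _ => sq_nonneg _).1 hS α (Finset.mem_univ α)
    exact norm_eq_zero.1 (pow_eq_zero_iff two_ne_zero |>.1 this)
  -- hence `ψ` vanishes (Plancherel)
  funext ⟨x, a, α⟩
  have hP := sum_norm_sq_eq_fourier (d := 4) (L := L) (fun y => ψ (y, a, α))
  simp only [hF, norm_zero, ne_eq, OfNat.ofNat_ne_zero, not_false_eq_true, zero_pow,
    Finset.sum_const_zero, mul_zero] at hP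
  have := (Finset.sum_eq_zero_iff_of_nonneg fun y _ => sq_nonneg _).1 hP x (Finset.mem_univ x)
  exact norm_eq_zero.1 (pow_eq_zero_iff two_ne_zero |>.1 this)

/-- Determinant form: for a non-resonant twist, `det D_W(U₀, m, 1) ≠ 0` for EVERY real bare mass `m`
(`D_W(m) = D_W(0) + m·1`, tree `wilsonDirac_mass_eq_add_scalar`). -/
theorem fermionDet_wilsonDirac_const_diag_ne_zero
    (hθ : ∀ (a : Fin 3) (j : ZMod L), Real.sin (2 * π * ((j.val : ℕ) : ℝ) / L + θ a) ≠ 0) (m : ℝ) :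
    fermionDet (wilsonDirac (fundamentalRep (Fin 3)) (fun _ : Edge 4 L => V) m 1) ≠ 0 := by
  intro hdet
  obtain ⟨ψ, hψne, hψ⟩ := Matrix.exists_mulVec_eq_zero_iff.2 hdet
  apply hψne
  refine wilsonDirac_const_diag_sub_injective θ V hV hθ (-m) ψ ?_
  rw [wilsonDirac_mass_eq_add_scalar, Matrix.add_mulVec] at hψ
  rw [← hψ, Complex.ofReal_neg, neg_smul, sub_neg_eq_add]
  congr 1
  rw [Matrix.scalar_apply, ← Matrix.smul_one_eq_diagonal, Matrix.smul_mulVec, Matrix.one_mulVec]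

end ConstDiag

/-! ## The witness: angles `(π/4L, π/4L, −π/2L)` -/

section Witness

variable {L : ℕ} [NeZero L]

/-- The angles `θ = (π/(4L), π/(4L), −π/(2L))` sum to zero. -/
theorem twistAngles_sum :
    (π / (4 * L) + (π / (4 * L) + -(π / (2 * L))) : ℝ) = 0 := by
  have hL : (L : ℝ) ≠ 0 := Nat.cast_ne_zero.2 (NeZero.ne L)
  field_simp
  ring

/-- **Non-resonance of the witness angles**: `sin (2π k/L + θ_a) ≠ 0` for every `k : ZMod L` and each of
`θ_a ∈ {π/(4L), −π/(2L)}` — the arguments are `π(8k+1)/(4L)` and `π(4k−1)/(2L)`, and `8k+1`, `4k−1` are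
odd while `4Ln`, `2Ln` are even. -/
theorem sin_twistAngle_ne_zero (a : Fin 3) (j : ZMod L) :
    Real.sin (2 * π * ((j.val : ℕ) : ℝ) / L + ![π / (4 * L), π / (4 * L), -(π / (2 * L))] a) ≠ 0 := by
  have hL : (0 : ℝ) < L := Nat.cast_pos.2 (Nat.pos_of_ne_zero (NeZero.ne L))
  have hπ : Real.pi ≠ 0 := Real.pi_ne_zero
  intro h
  obtain ⟨n, hn⟩ := Real.sin_eq_zero_iff.1 h
  fin_cases a
  · -- `n π = π (8k+1)/(4L)`
    simp only [Fin.zero_eta, Matrix.cons_val_zero] at hn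
    have h1 : (n : ℝ) * (4 * L) = 8 * (j.val : ℝ) + 1 := by
      have := hn
      field_simp at this
      nlinarith [this, Real.pi_pos]
    have h2 : (n * (4 * (L : ℤ)) : ℤ) = 8 * (j.val : ℤ) + 1 := by exact_mod_cast h1
    have h3 : (2 : ℤ) ∣ n * (4 * (L : ℤ)) := ⟨2 * n * L, by ring⟩
    rw [h2] at h3
    omega
  · simp only [Fin.mk_one, Matrix.cons_val_one, Matrix.cons_val_zero] at hn
    have h1 : (n : ℝ) * (4 * L) = 8 * (j.val : ℝ) + 1 := by
      have := hn
      field_simp at this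
      nlinarith [this, Real.pi_pos]
    have h2 : (n * (4 * (L : ℤ)) : ℤ) = 8 * (j.val : ℤ) + 1 := by exact_mod_cast h1
    have h3 : (2 : ℤ) ∣ n * (4 * (L : ℤ)) := ⟨2 * n * L, by ring⟩
    rw [h2] at h3
    omega
  · simp only [Fin.reduceFinMk, Matrix.cons_val] at hn
    have h1 : (n : ℝ) * (2 * L) = 4 * (j.val : ℝ) - 1 := by
      have := hn
      field_simp at this
      nlinarith [this, Real.pi_pos]
    have h2 : (n * (2 * (L : ℤ)) : ℤ) = 4 * (j.val : ℤ) - 1 := by exact_mod_cast h1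
    have h3 : (2 : ℤ) ∣ n * (2 * (L : ℤ)) := ⟨n * L, by ring⟩
    rw [h2] at h3
    omega

/-- **A gauge field without real Wilson modes.**  On every torus `(ℤ/L)⁴`, `L ≥ 1`, there is an `SU(3)`
gauge field `U₀` (the constant diagonal twist `diag(e^{iπ/4L}, e^{iπ/4L}, e^{−iπ/2L})` on all links) with
`det D_W(U₀, m, 1) ≠ 0` for EVERY real bare mass `m`: its massless `r = 1` Wilson–Dirac operator has no
real eigenvalue. -/
theorem exists_gaugeConfig_forall_fermionDet_ne_zero :
    ∃ U₀ : GaugeConfig 4 L SU3, ∀ m : ℝ, fermionDet (wilsonDirac (fundamentalRep (Fin 3)) U₀ m 1) ≠ 0 := by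
  set θ : Fin 3 → ℝ := ![π / (4 * L), π / (4 * L), -(π / (2 * L))] with hθ
  set D : Matrix (Fin 3) (Fin 3) ℂ := diagonal fun a => cexp (θ a * I) with hD
  have hunit : D ∈ Matrix.unitaryGroup (Fin 3) ℂ := by
    rw [Matrix.mem_unitaryGroup_iff, hD, star_eq_conjTranspose, diagonal_conjTranspose,
      diagonal_mul_diagonal, ← diagonal_one]
    congr 1
    funext a
    rw [Pi.star_apply, Complex.star_def, ← Complex.exp_conj, map_mul, Complex.conj_ofReal,
      Complex.conj_I, ← Complex.exp_add, mul_neg, add_neg_cancel, Complex.exp_zero]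
  have hdet : D.det = 1 := by
    rw [hD, det_diagonal, Fin.prod_univ_three, ← Complex.exp_add, ← Complex.exp_add]
    have : θ 0 * I + θ 1 * I + θ 2 * I = ((θ 0 + (θ 1 + θ 2) : ℝ) : ℂ) * I := by push_cast; ring
    rw [this, show θ 0 + (θ 1 + θ 2) = 0 from ?_, Complex.ofReal_zero, zero_mul, Complex.exp_zero]
    simp only [hθ, Matrix.cons_val_zero, Matrix.cons_val_one, Matrix.cons_val]
    exact twistAngles_sum
  refine ⟨fun _ => ⟨D, Matrix.mem_specialUnitaryGroup_iff.2 ⟨hunit, hdet⟩⟩, fun m => ?_⟩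
  exact fermionDet_wilsonDirac_const_diag_ne_zero θ ⟨D, _⟩ rfl (sin_twistAngle_ne_zero (L := L)) m

end Witness

end Summit.QuantumFields.QCD.Theorems.PositivityDeficitLeDefects
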